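import Summits.KontsevichZagierPeriods.KontsevichZagierPeriods.Theses.FurushoPentagon
import Summits.KontsevichZagierPeriods.KontsevichZagierPeriods.Theorems.FurushoPentagonPentagonInKZPathFamilies
import Summits.KontsevichZagierPeriods.KontsevichZagierPeriods.Theorems.FurushoPentagonPentagonInKZGroupLike
import Summits.KontsevichZagierPeriods.KontsevichZagierPeriods.Theorems.FurushoPentagonPentagonInKZCornersBlowupAlg
import Summits.KontsevichZagierPeriods.KontsevichZagierPeriods.Theorems.FurushoPentagonPentagonInKZCornersBlowupScaling
import Summits.KontsevichZagierPeriods.KontsevichZagierPeriods.Theorems.FurushoPentagonPentagonInKZCornersCubicalSides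
import Literature.NumberTheory.Transcendental.DrinfeldAssociatorRegularisation
import Literature.NumberTheory.Transcendental.AssociatorsEval
import Literature.NumberTheory.Transcendental.AssociatorsBaseChange

/-!
# `PentagonInKZ` (stmt-KontsevichZagierPeriods-11348), line `edge-normal-newton-leibniz`:
# stub `stub_cornersBlowup`

The log-free CORNER PRINCIPLE (hypothesis, verbatim the statement of the lead's stub
`stub_cornerPrinciple`) instantiated at the two EXCEPTIONAL vertices of the pentagon cell
`{0 < x < y < 1}` of `M₀,₅(ℝ)` read in the chart `x = uv, y = v` — the vertices on the exceptional
divisor `E` of the blow-up of `(u,v) = (1,1)` (residue `t₁₂+t₁₃+t₂₃`):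

* C3, vertex `E ∩ {u = 1}`, chart `u = 1-ξη`, `v = 1-η`, residues
  `t₁₂, t₁₂+t₁₃+t₂₃, t₀₁, t₀₁+t₀₂+t₁₂, t₁₃` — gives `M2·M10 = M1·M9`;
* C4, vertex `E ∩ {v = 1}`, chart `v = 1-ξη`, `u = 1-η`, residues
  `t₂₃, t₁₂+t₁₃+t₂₃, t₀₁+t₀₂+t₁₂, t₀₁, t₁₃` — gives `M2·M11 = M3·M12`

(`M p` = the end-regularised transport of the atlas path `p` of the first lead's skeleton
`Cruxes/PentagonInKZ/Lines/logfree-gauge-corner-flatness.lean`; `α = 1`, `β = 1/2`).  For each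
chart the corner principle yields `V_1(½)·H_0(1) = H_½(1)·V_0(½)` over
the chart alphabet `Fin 5`; each side is then identified with an atlas path by the side
transport `CornersCubical.side_transport_pl` (dead letters of density `0`, live letters mapped
to the atlas letter with the same density, letters `1-ξη`, `1-η` merging on `ξ = 1` with residue
`t₀₁ + (t₀₁+t₀₂+t₁₂)`).  The one new move: the side `η = 1/2` has poles `0, 2, -2` on the simplex
of side `1`; it is the atlas path `1` (resp. `3`), poles `0, 1, -1` on the simplex of side `1/2`,
after the dilation `t = 2t'` — one change of variables (Kontsevich–Zagier rule (2)) per word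
(`CornersBlowup.of_sub_of_mem_relations_of_dilation`, `CornersBlowup.pair_regEnd_eq_of_dilation`).

References: [Drinfeld1991, §2], [Furusho2011, §2], [KontsevichZagier2001, §1.2],
[IharaKanekoZagier2006, Cor. 5], [BrownModuli2009, §2].
-/

noncomputable section

open Literature.NumberTheory.Transcendental

namespace Summit.KontsevichZagierPeriods.FurushoPentagon.PentagonInKZ

namespace CornersBlowup

open CornersCubical

/-- **The side families of the blow-up charts** (common to C3 and C4, which share their
divisors `ξ, η, 1-ξη, 1-η, 1+ξ-ξη`): the divisors `φ_k`, the letter densities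
`f_k = ∂_ξ log φ_k`, `g_k = ∂_η log φ_k` (with their closed forms) and the four families of KZ
representations of the iterated integrals along the sides `η = 0`, `η = 1/2` (length `1`),
`ξ = 0`, `ξ = 1` (length `1/2`). [cite: KontsevichZagier2001, §1.1] -/
theorem families_B :
    ∃ (cf : Fin 5 → Fin 4 → ℚ) (φ f g : Fin 5 → ℝ → ℝ → ℝ),
      cf = ![![0, 1, 0, 0], ![0, 0, 1, 0], ![1, 0, 0, -1], ![1, 0, -1, 0], ![1, 1, 0, -1]] ∧
      (∀ k x y, φ k x y = cf k 0 + cf k 1 * x + cf k 2 * y + cf k 3 * x * y) ∧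
      (∀ k x y, f k x y = (cf k 1 + cf k 3 * y) / φ k x y) ∧
      (∀ k x y, g k x y = (cf k 2 + cf k 3 * x) / φ k x y) ∧
      (∀ x y : ℝ, (f 0 x y = 1 / x ∧ f 1 x y = 0 ∧ f 2 x y = -y / (1 - x * y) ∧ f 3 x y = 0 ∧
        f 4 x y = (1 - y) / (1 + x - x * y)) ∧ (g 0 x y = 0 ∧ g 1 x y = 1 / y ∧
        g 2 x y = -x / (1 - x * y) ∧ g 3 x y = -1 / (1 - y) ∧
        g 4 x y = -x / (1 + x - x * y))) ∧
      ∃ IHlo IHhi IVlo IVhi : (w : List (Fin 5)) → KZ.IntegralRep w.length,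
        (∀ w : List (Fin 5), w.getLast? ≠ some 0 →
          (IHlo w).domain = {t | (∀ i, 0 < t i ∧ t i < ((1 : ℚ) : ℝ)) ∧ StrictAnti t} ∧
          Set.EqOn (IHlo w).integrand (fun t => ∏ i, f (w.get i) (t i) 0) (IHlo w).domain) ∧
        (∀ w : List (Fin 5), w.getLast? ≠ some 0 →
          (IHhi w).domain = {t | (∀ i, 0 < t i ∧ t i < ((1 : ℚ) : ℝ)) ∧ StrictAnti t} ∧
          Set.EqOn (IHhi w).integrand (fun t => ∏ i, f (w.get i) (t i) ((1 / 2 : ℚ) : ℝ))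
            (IHhi w).domain) ∧
        (∀ w : List (Fin 5), w.getLast? ≠ some 1 →
          (IVlo w).domain = {t | (∀ i, 0 < t i ∧ t i < ((1 / 2 : ℚ) : ℝ)) ∧ StrictAnti t} ∧
          Set.EqOn (IVlo w).integrand (fun t => ∏ i, g (w.get i) 0 (t i)) (IVlo w).domain) ∧
        (∀ w : List (Fin 5), w.getLast? ≠ some 1 →
          (IVhi w).domain = {t | (∀ i, 0 < t i ∧ t i < ((1 / 2 : ℚ) : ℝ)) ∧ StrictAnti t} ∧
          Set.EqOn (IVhi w).integrand (fun t => ∏ i, g (w.get i) ((1 : ℚ) : ℝ) (t i))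
            (IVhi w).domain) := by
  -- the chart: divisors and letter densities
  obtain ⟨cf, hcf⟩ : ∃ cf : Fin 5 → Fin 4 → ℚ,
      cf = ![![0, 1, 0, 0], ![0, 0, 1, 0], ![1, 0, 0, -1], ![1, 0, -1, 0], ![1, 1, 0, -1]] :=
    ⟨_, rfl⟩
  obtain ⟨φ, f, g, hφ, hf, hg⟩ : ∃ φ f g : Fin 5 → ℝ → ℝ → ℝ,
      (∀ k x y, φ k x y = cf k 0 + cf k 1 * x + cf k 2 * y + cf k 3 * x * y) ∧
      (∀ k x y, f k x y = (cf k 1 + cf k 3 * y) / φ k x y) ∧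
      (∀ k x y, g k x y = (cf k 2 + cf k 3 * x) / φ k x y) :=
    ⟨_, _, _, fun _ _ _ => rfl, fun _ _ _ => rfl, fun _ _ _ => rfl⟩
  have hfg := fg_B cf hcf φ f g hφ hf hg
  have hβq : ∃ q : ℚ, ((1 / 2 : ℚ) : ℝ) = q := ⟨1 / 2, rfl⟩
  have hβ1 : ((1 / 2 : ℚ) : ℝ) ≤ 1 := by norm_num
  have hαq : ∃ q : ℚ, ((1 : ℚ) : ℝ) = q := ⟨1, rfl⟩
  have hα1 : ((1 : ℚ) : ℝ) ≤ 1 := by norm_num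
  have hq : ((1 / 2 : ℚ) : ℝ) = 2⁻¹ := by norm_num
  obtain ⟨q1, q2, q3⟩ := poles_012
  obtain ⟨r1, r2, r3⟩ := poles_0m2
  obtain ⟨s1, s2, s3⟩ := poles_02m
  -- the four side families
  obtain ⟨IHlo, hIHlo⟩ := exists_sideFamily ((1 : ℚ) : ℝ) hαq hα1 _ 0 r1 r2 r3
    (fun k s => f k s 0)
    (![some 0, none, none, none, some 1] : Fin 5 → Option (Fin 3)) 0 (by decide)
    (fun i s _ _ => by
      obtain ⟨⟨e0, e1, e2, e3, e4⟩, -, -, -⟩ := edge_B f g hfg s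
      fin_cases i <;> simp [e0, e1, e2, e3, e4])
  obtain ⟨IHhi, hIHhi⟩ := exists_sideFamily ((1 : ℚ) : ℝ) hαq hα1 _ 0 s1 s2 s3
    (fun k s => f k s ((1 / 2 : ℚ) : ℝ))
    (![some 0, none, some 1, none, some 2] : Fin 5 → Option (Fin 3)) 0 (by decide)
    (fun i s _ _ => by
      obtain ⟨-, ⟨e0, e1, e2, e3, e4⟩, -, -⟩ := edge_B f g hfg s
      simp only [hq]
      fin_cases i <;> simp [e0, e1, e2, e3, e4])
  obtain ⟨IVlo, hIVlo⟩ := exists_sideFamily ((1 / 2 : ℚ) : ℝ) hβq hβ1 _ 0 q1 q2 q3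
    (fun k s => g k 0 s)
    (![none, some 0, none, some 1, none] : Fin 5 → Option (Fin 3)) 1 (by decide)
    (fun i s _ _ => by
      obtain ⟨-, -, ⟨e0, e1, e2, e3, e4⟩, -⟩ := edge_B f g hfg s
      fin_cases i <;> simp [e0, e1, e2, e3, e4])
  obtain ⟨IVhi, hIVhi⟩ := exists_sideFamily ((1 / 2 : ℚ) : ℝ) hβq hβ1 _ 0 q1 q2 q3
    (fun k s => g k ((1 : ℚ) : ℝ) s)
    (![none, some 0, some 1, some 1, some 2] : Fin 5 → Option (Fin 3)) 1 (by decide)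
    (fun i s _ _ => by
      obtain ⟨-, -, -, ⟨e0, e1, e2, e3, e4⟩⟩ := edge_B f g hfg s
      simp only [Rat.cast_one]
      fin_cases i <;> simp [e0, e1, e2, e3, e4])
  exact ⟨cf, φ, f, g, hcf, hφ, hf, hg, hfg, IHlo, IHhi, IVlo, IVhi, hIHlo, hIHhi, hIVlo, hIVhi⟩

end CornersBlowup

open CornersBlowup CornersCubical

/-- **Stub `stub_cornersBlowup`**: the corner principle (hypothesis, verbatim the statement of
`stub_cornerPrinciple`) instantiated at the two EXCEPTIONAL vertices of the pentagon cell
`{0 < x < y < 1}` read in the chart `x = uv, y = v`, i.e. on the exceptional divisor of the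
blow-up of `(u,v) = (1,1)` (residue `t₁₂+t₁₃+t₂₃`): chart C3 (`u = 1-ξη, v = 1-η`, residues
`t₁₂, t₁₂+t₁₃+t₂₃, t₀₁, t₀₁+t₀₂+t₁₂, t₁₃`) gives `M2·M10 = M1·M9`, chart C4 (`v = 1-ξη, u = 1-η`,
residues `t₂₃, t₁₂+t₁₃+t₂₃, t₀₁+t₀₂+t₁₂, t₀₁, t₁₃`) gives `M2·M11 = M3·M12` (`α = 1`, `β = 1/2`;
the sides of length `1/2` and the side `η = 0` are atlas paths after merging letters of equal
density, the side `η = 1/2` — poles `0, 2, -2` on the simplex of side `1` — is the atlas path `1`,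
resp. `3`, after the dilation `t = 2t'`, one change of variables per word).
[cite: Drinfeld1991, §2] -/
theorem stub_cornersBlowup :
    (∀ (R : Type) [CommRing R] [Algebra ℚ R] (χ : KZ.FormalRep →+ R), (∀ c ∈ KZ.relations, χ c = 0) → (∀ x y : KZ.FormalRep, χ (x * y) = χ x * χ y) → (∃ u : KZ.FormalRep, χ u = 1) → ∀ (m N : ℕ) (α β : ℚ), 0 < α → 0 < β → ∀ (cf : Fin (m + 2) → Fin 4 → ℚ), cf 0 = ![0, 1, 0, 0] → cf 1 = ![0, 0, 1, 0] → ∀ (φ f g : Fin (m + 2) → ℝ → ℝ → ℝ), (∀ k x y, φ k x y = cf k 0 + cf k 1 * x + cf k 2 * y + cf k 3 * x * y) → (∀ k x y, f k x y = (cf k 1 + cf k 3 * y) / φ k x y) → (∀ k x y, g k x y = (cf k 2 + cf k 3 * x) / φ k x y) → (∀ k : Fin (m + 2), k ≠ 0 → k ≠ 1 → ∀ x y : ℝ, 0 ≤ x → x ≤ (α : ℝ) → 0 ≤ y → y ≤ (β : ℝ) → φ k x y ≠ 0) → ∀ (nZ : Fin (m + 2) → Fin 4 → Fin 4 → ℤ)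 (Zr : Fin (m + 2) → DrinfeldKohnoTrunc ℝ (Fin 4) N), (∀ k, Zr k = ∑ i : Fin 4, ∑ j : Fin 4, (nZ k i j : ℝ) • DrinfeldKohnoTrunc.t ℝ N i j) → Zr 0 * Zr 1 = Zr 1 * Zr 0 → (∀ x y : ℝ, 0 < x → x < (α : ℝ) → 0 < y → y < (β : ℝ) → ∑ k : Fin (m + 2), ∑ l : Fin (m + 2), (f k x y * g l x y) • (Zr k * Zr l - Zr l * Zr k) = 0) → (∀ y : ℝ, 0 < y → y < (β : ℝ) → ∑ l : Fin (m + 2), g l 0 y • (Zr 0 * Zr l - Zr l * Zr 0) = 0) → (∀ x : ℝ, 0 < x → x < (α : ℝ) → ∑ k : Fin (m + 2), f k x 0 • (Zr 1 * Zr k - Zr k * Zr 1) = 0) → ∀ (IHlo IHhi IVlo IVhi : (w : List (Fin (m + 2))) → KZ.IntegralRep w.length), (∀ w : List (Fin (m + 2)), w.getLast? ≠ some 0 → (IHlo w).domain = {t | (∀ i, 0 < t i ∧ t i < (α : ℝ)) ∧ StrictAnti t} ∧ Set.EqOn (IHlo w).integrand (fun t => ∏ i, f (w.get i) (t i) 0)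 (IHlo w).domain) → (∀ w : List (Fin (m + 2)), w.getLast? ≠ some 0 → (IHhi w).domain = {t | (∀ i, 0 < t i ∧ t i < (α : ℝ)) ∧ StrictAnti t} ∧ Set.EqOn (IHhi w).integrand (fun t => ∏ i, f (w.get i) (t i) (β : ℝ)) (IHhi w).domain) → (∀ w : List (Fin (m + 2)), w.getLast? ≠ some 1 → (IVlo w).domain = {t | (∀ i, 0 < t i ∧ t i < (β : ℝ)) ∧ StrictAnti t} ∧ Set.EqOn (IVlo w).integrand (fun t => ∏ i, g (w.get i) 0 (t i)) (IVlo w).domain) → (∀ w : List (Fin (m + 2)), w.getLast? ≠ some 1 → (IVhi w).domain = {t | (∀ i, 0 < t i ∧ t i < (β : ℝ)) ∧ StrictAnti t} ∧ Set.EqOn (IVhi w).integrand (fun t => ∏ i, g (w.get i) (α : ℝ) (t i)) (IVhi w).domain) → ∀ (PHlo PHhi PVlo PVhi : NCSeries (Fin (m + 2)) R), (∀ W, PHlo W = if W = [] then 1 else Shuffle.pair (fun w => χ (KZ.of (IHlo w))) (Shuffle.regEnd 0 W)) → (∀ W, PHhi W = if W = [] then 1 else Shuffle.pair (fun w => χ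 (KZ.of (IHhi w))) (Shuffle.regEnd 0 W)) → (∀ W, PVlo W = if W = [] then 1 else Shuffle.pair (fun w => χ (KZ.of (IVlo w))) (Shuffle.regEnd 1 W)) → (∀ W, PVhi W = if W = [] then 1 else Shuffle.pair (fun w => χ (KZ.of (IVhi w))) (Shuffle.regEnd 1 W)) → ∀ (Z : Fin (m + 2) → DrinfeldKohnoTrunc R (Fin 4) N), (∀ k, Z k = ∑ i : Fin 4, ∑ j : Fin 4, (nZ k i j : R) • DrinfeldKohnoTrunc.t R N i j) → NCSeries.evalTrunc N Z PVhi * NCSeries.evalTrunc N Z PHlo = NCSeries.evalTrunc N Z PHhi * NCSeries.evalTrunc N Z PVlo) → ∀ (R : Type) [CommRing R] [Algebra ℚ R] (χ : KZ.FormalRep →+ R), (∀ c ∈ KZ.relations, χ c = 0) → (∀ x y : KZ.FormalRep, χ (x * y) = χ x * χ y) → (∃ u : KZ.FormalRep, χ u = 1) → ∀ (I : (p : Fin 15) → (w : List (Fin 3)) → KZ.IntegralRep w.length), (∀ (p : Fin 15) (w : List (Fin 3)), w.getLast? ≠ some 0 → (I p w).domain = {t | (∀ i, 0 < t i ∧ t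 i < (![1/2, 1/2, 1/2, 1/2, 1/2, 1/2, 1/2, 1/2, 1/2, 1/2, 1, 1, 1/2, 1/2, 1/2] : Fin 15 → ℝ) p) ∧ StrictAnti t} ∧ Set.EqOn (I p w).integrand (fun t => ∏ i, 1 / (t i - (![![0, 1, 2], ![0, 1, -1], ![0, 1, 2], ![0, 1, -1], ![0, 1, 2], ![0, 1, 2], ![0, 1, 2], ![0, 1, 2], ![0, 1, 2], ![0, 1, 2], ![0, -1, 2], ![0, -1, 2], ![0, 1, 2], ![0, 1, 2], ![0, 1, 2]] : Fin 15 → Fin 3 → ℝ) p (w.get i))) (I p w).domain) → ∀ (P : Fin 15 → NCSeries (Fin 3) R), (∀ (p : Fin 15) (W : List (Fin 3)), P p W = if W = [] then 1 else Shuffle.pair (fun w => χ (KZ.of (I p w))) (Shuffle.regEnd 0 W)) → ∀ (N : ℕ) (a b c d e : DrinfeldKohnoTrunc R (Fin 4) N), a = DrinfeldKohnoTrunc.t R N 0 1 → b = DrinfeldKohnoTrunc.t R N 0 2 → c = DrinfeldKohnoTrunc.t R N 1 2 → d = DrinfeldKohnoTrunc.t R N 1 3 → e = DrinfeldKohnoTrunc.t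 R N 2 3 → ∀ (M : Fin 15 → DrinfeldKohnoTrunc R (Fin 4) N), (∀ p : Fin 15, M p = NCSeries.evalTrunc N ((![![a + b + c, e, d], ![c, a, d], ![c + d + e, a + a + b + c, d], ![e, a + b + c, d], ![a, c, d], ![a, c, 0], ![a + b + c, e, 0], ![c, a, 0], ![a + b + c, d + e, 0], ![c + d + e, a + b + c, 0], ![c, d, 0], ![e, d, 0], ![c + d + e, a, 0], ![a, c + d, 0], ![e, a + b + c, 0]] : Fin 15 → Fin 3 → DrinfeldKohnoTrunc R (Fin 4) N) p) (P p)) → M 2 * M 10 = M 1 * M 9 ∧ M 2 * M 11 = M 3 * M 12 := by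
  intro CP R _ _ χ hrel hmul hunit I hI P hP N a b c d e ha hb hc hd he M hM
  have hq : ((1 / 2 : ℚ) : ℝ) = 2⁻¹ := by norm_num
  -- the common divisors, densities and side families of the two charts, and their series
  obtain ⟨cf, φ, f, g, hcf, hφ, hf, hg, hfg, IHlo, IHhi, IVlo, IVhi, hIHlo, hIHhi, hIVlo, hIVhi⟩ :=
    families_B
  obtain ⟨PHlo, hPHlo⟩ : ∃ S : NCSeries (Fin 5) R, ∀ W, S W = if W = [] then 1 else
      Shuffle.pair (fun w => χ (KZ.of (IHlo w))) (Shuffle.regEnd 0 W) := ⟨_, fun _ => rfl⟩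
  obtain ⟨PHhi, hPHhi⟩ : ∃ S : NCSeries (Fin 5) R, ∀ W, S W = if W = [] then 1 else
      Shuffle.pair (fun w => χ (KZ.of (IHhi w))) (Shuffle.regEnd 0 W) := ⟨_, fun _ => rfl⟩
  obtain ⟨PVlo, hPVlo⟩ : ∃ S : NCSeries (Fin 5) R, ∀ W, S W = if W = [] then 1 else
      Shuffle.pair (fun w => χ (KZ.of (IVlo w))) (Shuffle.regEnd 1 W) := ⟨_, fun _ => rfl⟩
  obtain ⟨PVhi, hPVhi⟩ : ∃ S : NCSeries (Fin 5) R, ∀ W, S W = if W = [] then 1 else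
      Shuffle.pair (fun w => χ (KZ.of (IVhi w))) (Shuffle.regEnd 1 W) := ⟨_, fun _ => rfl⟩
  -- the side `η = 1/2` read on the simplex of side `1` (poles `0, 2, -2`), and its
  -- identification with the atlas paths `1`, `3` (poles `0, 1, -1`, side `1/2`) by `t = 2t'`
  obtain ⟨s1, s2, s3⟩ := poles_02m
  obtain ⟨Ia', hIa'⟩ := exists_sideFamily ((1 : ℚ) : ℝ) ⟨1, rfl⟩ (by norm_num)
    (![0, 2, -2] : Fin 3 → ℝ) 0 s1 s2 s3 (fun b s => 1 / (s - (![0, 2, -2] : Fin 3 → ℝ) b))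
    (fun b => some b) 0 (fun i h => by simpa using h) (fun i s _ _ => rfl)
  have hP13 : ∀ p : Fin 15, p = 1 ∨ p = 3 → ∀ W, P p W = if W = [] then 1 else
      Shuffle.pair (fun w => χ (KZ.of (Ia' w))) (Shuffle.regEnd 0 W) := by
    intro p hp W
    rw [hP p W, pair_regEnd_eq_of_dilation χ hrel 2 two_pos _ ((1 : ℚ) : ℝ) ?_ _
      (![0, 2, -2] : Fin 3 → ℝ) ?_ 0 (I p) (hI p) Ia' hIa' W]
    · rcases hp with rfl | rfl <;> simp
    · intro b
      rcases hp with rfl | rfl <;> fin_cases b <;> simp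
  have C3 : M 2 * M 10 = M 1 * M 9 := by
    obtain ⟨Z5, hZ5⟩ : ∃ Z5 : Fin 5 → DrinfeldKohnoTrunc R (Fin 4) N,
        Z5 = (![c, c + d + e, a, a + b + c, d] : Fin 5 → DrinfeldKohnoTrunc R (Fin 4) N) := ⟨_, rfl⟩
    -- the corner principle at the chart
    have key : NCSeries.evalTrunc N Z5 PVhi * NCSeries.evalTrunc N Z5 PHlo =
        NCSeries.evalTrunc N Z5 PHhi * NCSeries.evalTrunc N Z5 PVlo := by
      refine CP R χ hrel hmul hunit 3 N 1 (1 / 2) (by norm_num) (by norm_num) cf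
        (by subst hcf; rfl) (by subst hcf; rfl) φ f g hφ hf hg (hreg_B cf hcf φ hφ) _ _
        (fun k => (sum_nZ_C3 (S := ℝ) (N := N) _ rfl k).symm) (comm01_C3 _ rfl)
        (fun x y hx0 hx1 hy0 hy1 => ?_) (fun y hy0 hy1 => ?_) (fun x hx0 hx1 => ?_)
        IHlo IHhi IVlo IVhi hIHlo hIHhi hIVlo hIVhi PHlo PHhi PVlo PVhi hPHlo hPHhi hPVlo hPVhi
        Z5 (by subst ha hb hc hd he hZ5; exact fun k => (sum_nZ_C3 (S := R) (N := N) _ rfl k).symm)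
      · -- flatness on the open chart
        obtain ⟨⟨-, a1, -, a3, -⟩, b0, -⟩ := hfg x y
        obtain ⟨h1, h2, h3⟩ := scalar_B f g hfg x y hx0 hx1 hy0 hy1
        exact flat_C3 _ rfl (fun k => f k x y) (fun l => g l x y) a1 a3 b0 h1 h2 h3
      · -- centrality of `Z₀` on the edge `ξ = 0`
        obtain ⟨-, b0, -, b2, -, b4⟩ := hfg 0 y
        exact central0_C3 _ rfl (fun l => g l 0 y) b0 (by rw [b2]; simp) (by rw [b4]; simp)
      · -- centrality of `Z₁` on the edge `η = 0`
        obtain ⟨⟨-, a1, a2, a3, -⟩, -⟩ := hfg x 0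
        exact central1_C3 _ rfl (fun k => f k x 0) a1 (by rw [a2]; simp) a3
    -- the four sides are atlas paths
    have TVh : NCSeries.evalTrunc N Z5 PVhi = M 2 := by
      rw [hM]
      refine side_transport_pl χ hrel ((1 / 2 : ℚ) : ℝ) (fun k s => g k ((1 : ℚ) : ℝ) s) _ 1 0
        (![none, some 0, some 1, some 1, some 2] : Fin 5 → Option (Fin 3)) rfl (by decide) ?_
        IVhi hIVhi (I 2) _ (by simp) (hI 2) PVhi hPVhi (P 2) (hP 2) N _ _ ?_
      · intro i s _ _
        obtain ⟨-, -, -, ⟨e0, e1, e2, e3, e4⟩⟩ := edge_B f g hfg s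
        simp only [Rat.cast_one]
        fin_cases i <;> simp [e0, e1, e2, e3, e4]
      · intro b
        fin_cases b <;> simp [hZ5, Finset.sum_filter, Fin.sum_univ_five]
        abel
    have TH0 : NCSeries.evalTrunc N Z5 PHlo = M 10 := by
      rw [hM]
      refine side_transport_pl χ hrel ((1 : ℚ) : ℝ) (fun k s => f k s 0) _ 0 0
        (![some 0, none, none, none, some 1] : Fin 5 → Option (Fin 3)) rfl (by decide) ?_
        IHlo hIHlo (I 10) _ (by simp) (hI 10) PHlo hPHlo (P 10) (hP 10) N _ _ ?_
      · intro i s _ _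
        obtain ⟨⟨e0, e1, e2, e3, e4⟩, -, -, -⟩ := edge_B f g hfg s
        fin_cases i <;> simp [e0, e1, e2, e3, e4]
      · intro b
        fin_cases b <;> simp [hZ5, Finset.sum_filter, Fin.sum_univ_five]
    have THh : NCSeries.evalTrunc N Z5 PHhi = M 1 := by
      rw [hM]
      refine side_transport_pl χ hrel ((1 : ℚ) : ℝ) (fun k s => f k s ((1 / 2 : ℚ) : ℝ))
        (![0, 2, -2] : Fin 3 → ℝ) 0 0
        (![some 0, none, some 1, none, some 2] : Fin 5 → Option (Fin 3)) rfl (by decide) ?_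
        IHhi hIHhi Ia' _ rfl hIa' PHhi hPHhi (P 1) (hP13 1 (by decide)) N _ _ ?_
      · intro i s _ _
        obtain ⟨-, ⟨e0, e1, e2, e3, e4⟩, -, -⟩ := edge_B f g hfg s
        simp only [hq]
        fin_cases i <;> simp [e0, e1, e2, e3, e4]
      · intro b
        fin_cases b <;> simp [hZ5, Finset.sum_filter, Fin.sum_univ_five]
    have TV0 : NCSeries.evalTrunc N Z5 PVlo = M 9 := by
      rw [hM]
      refine side_transport_pl χ hrel ((1 / 2 : ℚ) : ℝ) (fun k s => g k 0 s) _ 1 0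
        (![none, some 0, none, some 1, none] : Fin 5 → Option (Fin 3)) rfl (by decide) ?_
        IVlo hIVlo (I 9) _ (by simp) (hI 9) PVlo hPVlo (P 9) (hP 9) N _ _ ?_
      · intro i s _ _
        obtain ⟨-, -, ⟨e0, e1, e2, e3, e4⟩, -⟩ := edge_B f g hfg s
        fin_cases i <;> simp [e0, e1, e2, e3, e4]
      · intro b
        fin_cases b <;> simp [hZ5, Finset.sum_filter, Fin.sum_univ_five]
    rw [TVh, TH0, THh, TV0] at key
    exact key
  have C4 : M 2 * M 11 = M 3 * M 12 := by
    obtain ⟨Z5, hZ5⟩ : ∃ Z5 : Fin 5 → DrinfeldKohnoTrunc R (Fin 4) N,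
        Z5 = (![e, c + d + e, a + b + c, a, d] : Fin 5 → DrinfeldKohnoTrunc R (Fin 4) N) := ⟨_, rfl⟩
    -- the corner principle at the chart
    have key : NCSeries.evalTrunc N Z5 PVhi * NCSeries.evalTrunc N Z5 PHlo =
        NCSeries.evalTrunc N Z5 PHhi * NCSeries.evalTrunc N Z5 PVlo := by
      refine CP R χ hrel hmul hunit 3 N 1 (1 / 2) (by norm_num) (by norm_num) cf
        (by subst hcf; rfl) (by subst hcf; rfl) φ f g hφ hf hg (hreg_B cf hcf φ hφ) _ _
        (fun k => (sum_nZ_C4 (S := ℝ) (N := N) _ rfl k).symm) (comm01_C4 _ rfl)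
        (fun x y hx0 hx1 hy0 hy1 => ?_) (fun y hy0 hy1 => ?_) (fun x hx0 hx1 => ?_)
        IHlo IHhi IVlo IVhi hIHlo hIHhi hIVlo hIVhi PHlo PHhi PVlo PVhi hPHlo hPHhi hPVlo hPVhi
        Z5 (by subst ha hb hc hd he hZ5; exact fun k => (sum_nZ_C4 (S := R) (N := N) _ rfl k).symm)
      · -- flatness on the open chart
        obtain ⟨⟨-, a1, -, a3, -⟩, b0, -⟩ := hfg x y
        obtain ⟨h1, h2, h3⟩ := scalar_B f g hfg x y hx0 hx1 hy0 hy1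
        exact flat_C4 _ rfl (fun k => f k x y) (fun l => g l x y) a1 a3 b0 h1 h2 h3
      · -- centrality of `Z₀` on the edge `ξ = 0`
        obtain ⟨-, b0, -, b2, -, b4⟩ := hfg 0 y
        exact central0_C4 _ rfl (fun l => g l 0 y) b0 (by rw [b2]; simp) (by rw [b4]; simp)
      · -- centrality of `Z₁` on the edge `η = 0`
        obtain ⟨⟨-, a1, a2, a3, -⟩, -⟩ := hfg x 0
        exact central1_C4 _ rfl (fun k => f k x 0) a1 (by rw [a2]; simp) a3
    -- the four sides are atlas paths
    have TVh : NCSeries.evalTrunc N Z5 PVhi = M 2 := by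
      rw [hM]
      refine side_transport_pl χ hrel ((1 / 2 : ℚ) : ℝ) (fun k s => g k ((1 : ℚ) : ℝ) s) _ 1 0
        (![none, some 0, some 1, some 1, some 2] : Fin 5 → Option (Fin 3)) rfl (by decide) ?_
        IVhi hIVhi (I 2) _ (by simp) (hI 2) PVhi hPVhi (P 2) (hP 2) N _ _ ?_
      · intro i s _ _
        obtain ⟨-, -, -, ⟨e0, e1, e2, e3, e4⟩⟩ := edge_B f g hfg s
        simp only [Rat.cast_one]
        fin_cases i <;> simp [e0, e1, e2, e3, e4]
      · intro b
        fin_cases b <;> simp [hZ5, Finset.sum_filter, Fin.sum_univ_five]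
        abel
    have TH0 : NCSeries.evalTrunc N Z5 PHlo = M 11 := by
      rw [hM]
      refine side_transport_pl χ hrel ((1 : ℚ) : ℝ) (fun k s => f k s 0) _ 0 0
        (![some 0, none, none, none, some 1] : Fin 5 → Option (Fin 3)) rfl (by decide) ?_
        IHlo hIHlo (I 11) _ (by simp) (hI 11) PHlo hPHlo (P 11) (hP 11) N _ _ ?_
      · intro i s _ _
        obtain ⟨⟨e0, e1, e2, e3, e4⟩, -, -, -⟩ := edge_B f g hfg s
        fin_cases i <;> simp [e0, e1, e2, e3, e4]
      · intro b
        fin_cases b <;> simp [hZ5, Finset.sum_filter, Fin.sum_univ_five]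
    have THh : NCSeries.evalTrunc N Z5 PHhi = M 3 := by
      rw [hM]
      refine side_transport_pl χ hrel ((1 : ℚ) : ℝ) (fun k s => f k s ((1 / 2 : ℚ) : ℝ))
        (![0, 2, -2] : Fin 3 → ℝ) 0 0
        (![some 0, none, some 1, none, some 2] : Fin 5 → Option (Fin 3)) rfl (by decide) ?_
        IHhi hIHhi Ia' _ rfl hIa' PHhi hPHhi (P 3) (hP13 3 (by decide)) N _ _ ?_
      · intro i s _ _
        obtain ⟨-, ⟨e0, e1, e2, e3, e4⟩, -, -⟩ := edge_B f g hfg s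
        simp only [hq]
        fin_cases i <;> simp [e0, e1, e2, e3, e4]
      · intro b
        fin_cases b <;> simp [hZ5, Finset.sum_filter, Fin.sum_univ_five]
    have TV0 : NCSeries.evalTrunc N Z5 PVlo = M 12 := by
      rw [hM]
      refine side_transport_pl χ hrel ((1 / 2 : ℚ) : ℝ) (fun k s => g k 0 s) _ 1 0
        (![none, some 0, none, some 1, none] : Fin 5 → Option (Fin 3)) rfl (by decide) ?_
        IVlo hIVlo (I 12) _ (by simp) (hI 12) PVlo hPVlo (P 12) (hP 12) N _ _ ?_
      · intro i s _ _
        obtain ⟨-, -, ⟨e0, e1, e2, e3, e4⟩, -⟩ := edge_B f g hfg s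
        fin_cases i <;> simp [e0, e1, e2, e3, e4]
      · intro b
        fin_cases b <;> simp [hZ5, Finset.sum_filter, Fin.sum_univ_five]
    rw [TVh, TH0, THh, TV0] at key
    exact key
  exact ⟨C3, C4⟩

/-- **Sub-stub `cornersBlowup_familiesB` of `stub_cornersBlowup`**: the common divisors, letter
densities (with closed forms) and the four side families of KZ representations of the blow-up
corner charts C3, C4 of the pentagon cell (chart `[0, 1] × [0, 1/2]`).
[cite: KontsevichZagier2001, §1.1] -/
theorem cornersBlowup_familiesB :
    ∃ (cf : Fin 5 → Fin 4 → ℚ) (φ f g : Fin 5 → ℝ → ℝ → ℝ), cf = ![![0, 1, 0, 0], ![0, 0, 1, 0], ![1, 0, 0, -1], ![1, 0, -1, 0], ![1, 1, 0, -1]] ∧ (∀ k x y, φ k x y = cf k 0 + cf k 1 * x + cf k 2 * y + cf k 3 * x * y) ∧ (∀ k x y, f k x y = (cf k 1 + cf k 3 * y) / φ k x y) ∧ (∀ k x y, g k x y = (cf k 2 + cf k 3 * x) / φ k x y) ∧ (∀ x y : ℝ, (f 0 x y = 1 / x ∧ f 1 x y = 0 ∧ f 2 x y = -y / (1 - x *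 y) ∧ f 3 x y = 0 ∧ f 4 x y = (1 - y) / (1 + x - x * y)) ∧ (g 0 x y = 0 ∧ g 1 x y = 1 / y ∧ g 2 x y = -x / (1 - x * y) ∧ g 3 x y = -1 / (1 - y) ∧ g 4 x y = -x / (1 + x - x * y))) ∧ ∃ IHlo IHhi IVlo IVhi : (w : List (Fin 5)) → KZ.IntegralRep w.length, (∀ w : List (Fin 5), w.getLast? ≠ some 0 → (IHlo w).domain = {t | (∀ i, 0 < t i ∧ t i < ((1 : ℚ) : ℝ)) ∧ StrictAnti t} ∧ Set.EqOn (IHlo w).integrand (fun t => ∏ i, f (w.get i) (t i) 0) (IHlo w).domain) ∧ (∀ w : List (Fin 5), w.getLast? ≠ some 0 → (IHhi w).domain = {t | (∀ i, 0 < t i ∧ t i < ((1 : ℚ) : ℝ)) ∧ StrictAnti t} ∧ Set.EqOn (IHhi w).integrand (fun t => ∏ i, f (w.get i) (t i) ((1 / 2 : ℚ) : ℝ)) (IHhi w).domain) ∧ (∀ w : List (Fin 5), w.getLast? ≠ some 1 → (IVlo w).domain = {t | (∀ i, 0 < t i ∧ t i < ((1 / 2 : ℚ) : ℝ)) ∧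 StrictAnti t} ∧ Set.EqOn (IVlo w).integrand (fun t => ∏ i, g (w.get i) 0 (t i)) (IVlo w).domain) ∧ (∀ w : List (Fin 5), w.getLast? ≠ some 1 → (IVhi w).domain = {t | (∀ i, 0 < t i ∧ t i < ((1 / 2 : ℚ) : ℝ)) ∧ StrictAnti t} ∧ Set.EqOn (IVhi w).integrand (fun t => ∏ i, g (w.get i) ((1 : ℚ) : ℝ) (t i)) (IVhi w).domain) :=
  CornersBlowup.families_B

/-- **Sub-stub `cornersBlowup_corners`** (the gate's registered hook for this file): the SAME
proposition as `stub_cornersBlowup` — the corner principle (hypothesis) implies the two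
exceptional corner identities `M2M10 = M1M9`, `M2M11 = M3M12` of the fifteen-path atlas — written
with inferable binder types and spaces dropped (the registered signature of `stub_cornersBlowup`
exceeds the registry's length limit); it is `stub_cornersBlowup` itself. [cite: Drinfeld1991, §2] -/
theorem cornersBlowup_corners :
    (∀ (R : Type) [CommRing R] [Algebra ℚ R] (χ : KZ.FormalRep →+ R), (∀ c ∈ KZ.relations, χ c = 0)→(∀ x y : KZ.FormalRep, χ (x * y) = χ x * χ y)→(∃ u, χ u = 1)→∀ (m N : ℕ) (α β : ℚ), 0 < α→0 < β→∀ (cf : Fin (m + 2)→Fin 4→ℚ), cf 0 = ![0,1,0,0]→cf 1 = ![0,0,1,0]→∀ (φ f g : Fin (m + 2)→ℝ→ℝ→ℝ), (∀ k x y, φ k x y = cf k 0 + cf k 1 * x + cf k 2 * y + cf k 3 * x * y)→(∀ k x y, f k x y = (cf k 1 + cf k 3 * y) / φ k x y)→(∀ k x y, g k x y = (cf k 2 + cf k 3 * x) / φ k x y)→(∀ k : Fin (m + 2), k ≠ 0→k ≠ 1→∀ x y : ℝ, 0 ≤ x→x ≤ (α : ℝ)→0 ≤ y→y ≤ (β :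 ℝ)→φ k x y ≠ 0)→∀ (nZ : Fin (m + 2)→Fin 4→Fin 4→ℤ) (Zr : Fin (m + 2)→DrinfeldKohnoTrunc ℝ (Fin 4) N), (∀ k, Zr k = ∑ i, ∑ j, (nZ k i j : ℝ) • DrinfeldKohnoTrunc.t ℝ N i j)→Zr 0 * Zr 1 = Zr 1 * Zr 0→(∀ x y : ℝ, 0 < x→x < (α : ℝ)→0 < y→y < (β : ℝ)→∑ k, ∑ l, (f k x y * g l x y) • (Zr k * Zr l - Zr l * Zr k) = 0)→(∀ y : ℝ, 0 < y→y < (β : ℝ)→∑ l, g l 0 y • (Zr 0 * Zr l - Zr l * Zr 0) = 0)→(∀ x : ℝ, 0 < x→x < (α : ℝ)→∑ k, f k x 0 • (Zr 1 * Zr k - Zr k * Zr 1) = 0)→∀ (Hl Hh Vl Vh : (w : List (Fin (m + 2)))→KZ.IntegralRep w.length), (∀ w : List (Fin (m + 2)), w.getLast? ≠ some 0→(Hl w).domain = {t | (∀ i, 0 < t i ∧ t i < (α : ℝ)) ∧ StrictAnti t} ∧ Set.EqOn (Hl w).integrand (fun t => ∏ i, f (w.get i) (t i) 0) (Hl w).domain)→(∀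 w : List (Fin (m + 2)), w.getLast? ≠ some 0→(Hh w).domain = {t | (∀ i, 0 < t i ∧ t i < (α : ℝ)) ∧ StrictAnti t} ∧ Set.EqOn (Hh w).integrand (fun t => ∏ i, f (w.get i) (t i) (β : ℝ)) (Hh w).domain)→(∀ w : List (Fin (m + 2)), w.getLast? ≠ some 1→(Vl w).domain = {t | (∀ i, 0 < t i ∧ t i < (β : ℝ)) ∧ StrictAnti t} ∧ Set.EqOn (Vl w).integrand (fun t => ∏ i, g (w.get i) 0 (t i)) (Vl w).domain)→(∀ w : List (Fin (m + 2)), w.getLast? ≠ some 1→(Vh w).domain = {t | (∀ i, 0 < t i ∧ t i < (β : ℝ)) ∧ StrictAnti t} ∧ Set.EqOn (Vh w).integrand (fun t => ∏ i, g (w.get i) (α : ℝ) (t i)) (Vh w).domain)→∀ (Pl Ph Ql Qh : NCSeries (Fin (m + 2)) R), (∀ W, Pl W = if W = [] then 1 else Shuffle.pair (fun w => χ (KZ.of (Hl w))) (Shuffle.regEnd 0 W))→(∀ W, Ph W = if W = [] then 1 else Shuffle.pair (fun w => χ (KZ.of (Hh w))) (Shuffle.regEnd 0 W))→(∀ W,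 Ql W = if W = [] then 1 else Shuffle.pair (fun w => χ (KZ.of (Vl w))) (Shuffle.regEnd 1 W))→(∀ W, Qh W = if W = [] then 1 else Shuffle.pair (fun w => χ (KZ.of (Vh w))) (Shuffle.regEnd 1 W))→∀ (Z : Fin (m + 2)→DrinfeldKohnoTrunc R (Fin 4) N), (∀ k, Z k = ∑ i, ∑ j, (nZ k i j : R) • DrinfeldKohnoTrunc.t R N i j)→NCSeries.evalTrunc N Z Qh * NCSeries.evalTrunc N Z Pl = NCSeries.evalTrunc N Z Ph * NCSeries.evalTrunc N Z Ql)→∀ (R : Type) [CommRing R] [Algebra ℚ R] (χ : KZ.FormalRep →+ R), (∀ c ∈ KZ.relations, χ c = 0)→(∀ x y : KZ.FormalRep, χ (x * y) = χ x * χ y)→(∃ u, χ u = 1)→∀ (I : (p : Fin 15)→(w : List (Fin 3))→KZ.IntegralRep w.length), (∀ (p : Fin 15) (w : List (Fin 3)), w.getLast? ≠ some 0→(I p w).domain = {t | (∀ i, 0 < t i ∧ t i < (![1/2,1/2,1/2,1/2,1/2,1/2,1/2,1/2,1/2,1/2,1,1,1/2,1/2,1/2] : Fin 15→ℝ) p)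 ∧ StrictAnti t} ∧ Set.EqOn (I p w).integrand (fun t => ∏ i, 1 / (t i - (![![0,1,2],![0,1,-1],![0,1,2],![0,1,-1],![0,1,2],![0,1,2],![0,1,2],![0,1,2],![0,1,2],![0,1,2],![0,-1,2],![0,-1,2],![0,1,2],![0,1,2],![0,1,2]] : Fin 15→Fin 3→ℝ) p (w.get i))) (I p w).domain)→∀ (P : Fin 15→NCSeries (Fin 3) R), (∀ p W, P p W = if W = [] then 1 else Shuffle.pair (fun w => χ (KZ.of (I p w))) (Shuffle.regEnd 0 W))→∀ (N : ℕ) (a b c d e : DrinfeldKohnoTrunc R (Fin 4) N), a = DrinfeldKohnoTrunc.t R N 0 1→b = DrinfeldKohnoTrunc.t R N 0 2→c = DrinfeldKohnoTrunc.t R N 1 2→d = DrinfeldKohnoTrunc.t R N 1 3→e = DrinfeldKohnoTrunc.t R N 2 3→∀ (M : Fin 15→DrinfeldKohnoTrunc R (Fin 4) N), (∀ p, M p = NCSeries.evalTrunc N ((![![a+b+c,e,d],![c,a,d],![c+d+e,a+a+b+c,d],![e,a+b+c,d],![a,c,d],![a,c,0],![a+b+c,e,0],![c,a,0],![a+b+c,d+e,0],![c+d+e,a+b+c,0],![c,d,0],![e,d,0],![c+d+e,a,0],![a,c+d,0],![e,a+b+c,0]]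 : Fin 15→Fin 3→DrinfeldKohnoTrunc R (Fin 4) N) p) (P p))→M 2 * M 10 = M 1 * M 9 ∧ M 2 * M 11 = M 3 * M 12 :=
  stub_cornersBlowup

end Summit.KontsevichZagierPeriods.FurushoPentagon.PentagonInKZ
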